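import Summits.Ventures.PercRepro.S2ElevenEightK2NuSeven
import Summits.Ventures.PercRepro.S2FlatSharp
import Summits.Ventures.PercRepro.S2SpreadTail
import Summits.Ventures.PercRepro.S2CountsCell
import Summits.Ventures.PercRepro.S1SpreadCapsEight

/-!
# PercRepro — S2: THE SPREAD CASE OF THE CELL `(11, 8)` OF `(13, 8)` AT `K₂`, AND THE CELL MODULO `ν = 4` (p7, gen 17)

The kit's spread levers (`topCount_le_flat_sharp` at `(8, 7)`, the spread tail, the kit's spanning count) on the caps `13 / 99 / 651` (the standard caps, coloops allowed):
`#U ≤ 51954`, `A = 1062692 / 15`, `S = 169766`, `m = 470`. **`c025_eleven_eight_k2_spread`**, **`c025_eleven_eight_k2_of_nu_four`** (the scaled cell modulo its case `ν = 4`).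
Nothing about any cell is claimed. Axioms: standard.
-/

open scoped Matroid

namespace PercRepro

namespace ThmN

open Set

variable {α : Type}

/-- **The spread case of the coloop-free cell `(11, 8)`**, on p1's nullity-`8` spread caps. -/
theorem c025_eleven_eight_k2_spread (M : Matroid α) [M.Finite]
    (hR : M.eRank = ((11 : ℕ) : ℕ∞)) (hn : M.E.ncard = 11 + 8)
    (hfree : ∀ e ∈ M.E, ∃ A ⊆ M.E \ {e}, e ∉ M.closure A ∧ e ∉ M.closure ((M.E \ {e}) \ A))
    (h4 : ¬ ∃ W ⊆ M.E, W.ncard ≤ 9 ∧ W.encard = M.eRk W + 4) :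
    ((phiK 13 5 - 6) / 4) * (Matroid.topCount M 11 5 : ℚ) ≤ (Matroid.midCount M 11 5 : ℚ) := by
  classical
  have hd : M.E.encard = M.eRank + ((8 : ℕ) : ℕ∞) := by
    rw [hR, ← M.ground_finite.cast_ncard_eq, hn]
    push_cast
    ring
  have hd' : M.E.encard = M.eRank + 8 := by rw [hd]; rfl
  obtain ⟨hs3, hs4c, hs5c⟩ := caps_eleven_eight M hd hfree
  have hflat : ∀ X ⊆ M.E, M.eRk X ≤ 5 → X.ncard ≤ 8 := fun X hX hr => by
    have := S2.ncard_le_of_eRk_le_of_not_nullity M 4 9 (by norm_num) h4 hX (r := 5) (by norm_num) (by exact_mod_cast hr)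
    omega
  have hflat' : ∀ X ⊆ M.E, M.eRk X ≤ 4 → X.ncard ≤ 7 := fun X hX hr => by
    have := S2.ncard_le_of_eRk_le_of_not_nullity M 4 9 (by norm_num) h4 hX (r := 4) (by norm_num) (by exact_mod_cast hr)
    omega
  have hEcard : M.ground_finite.toFinset.card = 11 + 8 := by
    rw [← Set.ncard_eq_toFinset_card _ M.ground_finite]; exact hn
  -- the top count (the spread lever with the triangle term), the tail and the spanning count
  have hU := topCount_le_flat_sharp M 11 8 (by norm_num) (by norm_num) hR hn hfree 8 7 hflat hflat' (by norm_num) (by norm_num)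
    13 99 651 hs3 hs4c hs5c
  have hU' : Matroid.topCount M 11 5 ≤ 51954 := by
    have h : (Matroid.topCount M 11 5 : ℚ) ≤ 51954 := by
      refine hU.trans ?_
      norm_num [Finset.sum_range_succ, Nat.choose]
    exact_mod_cast h
  have hA := ncard_eRk_le_five_le_spread M 11 8 (by norm_num) hR hn hfree hflat hflat' 13 99 651 hs3 hs4c hs5c
  have hA' : ({X : Set α | X ⊆ M.E ∧ M.eRk X ≤ 5}.ncard : ℚ) ≤ 1062692 / 15 := by
    refine hA.trans ?_
    norm_num [Nat.choose]
  have hS' : {X : Set α | X ⊆ M.E ∧ M.eRk X = M.eRank}.ncard ≤ 169766 := by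
    have hS := Matroid.ncard_spanning_le (M := M) hd
    rw [hEcard] at hS
    exact hS.trans (by decide)
  exact c025_core_five_cell_of_counts_xqictq5g M 11 8 (by norm_num) hR hn 51954 hU' _ hA' 169766 hS'
    12107 (by norm_num) ((phiK 13 5 - 6) / 4) (by rw [phiK_thirteen_five]; norm_num) ⟨470, by norm_num, by norm_num, by norm_num⟩

/-- **The cell `(11, 8)` of `(13, 8)` at `K₂` modulo its case `ν = 4`** (the cases `ν = 7, 6, 5` and the spread case are theorems). -/
theorem c025_eleven_eight_k2_of_nu_four
    (hnu4 : ∀ (M : Matroid α) [M.Finite], M.eRank = ((11 : ℕ) : ℕ∞) → M.E.ncard = 11 + 8 →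
      (∀ e ∈ M.E, ∃ A ⊆ M.E \ {e}, e ∉ M.closure A ∧ e ∉ M.closure ((M.E \ {e}) \ A)) →
      ¬ (∃ W ⊆ M.E, W.ncard ≤ 12 ∧ W.encard = M.eRk W + 7) → ¬ (∃ W ⊆ M.E, W.ncard ≤ 11 ∧ W.encard = M.eRk W + 6) →
      ¬ (∃ W ⊆ M.E, W.ncard ≤ 10 ∧ W.encard = M.eRk W + 5) → (∃ W ⊆ M.E, W.ncard ≤ 9 ∧ W.encard = M.eRk W + 4) →
      ((phiK 13 5 - 6) / 4) * (Matroid.topCount M 11 5 : ℚ) ≤ (Matroid.midCount M 11 5 : ℚ))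
    (M : Matroid α) [M.Finite]
    (hR : M.eRank = ((11 : ℕ) : ℕ∞)) (hn : M.E.ncard = 11 + 8)
    (hfree : ∀ e ∈ M.E, ∃ A ⊆ M.E \ {e}, e ∉ M.closure A ∧ e ∉ M.closure ((M.E \ {e}) \ A)) :
    ((phiK 13 5 - 6) / 4) * (Matroid.topCount M 11 5 : ℚ) ≤ (Matroid.midCount M 11 5 : ℚ) :=
  c025_eleven_eight_k2_of_nu_four_of_spread hnu4
    (fun M' _ hR' hn' hfree' h4' => c025_eleven_eight_k2_spread M' hR' hn' hfree' h4') M hR hn hfree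

end ThmN

end PercRepro
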